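import Literature.Geometry.Lorentzian.Stationary
import Literature.Geometry.Lorentzian.Einstein
import Literature.Geometry.Lorentzian.Geodesic
import Literature.Geometry.Lorentzian.Curvature
import HarnessLib

/-!
# Anderson's rigidity of complete stationary vacuum spacetimes (Anderson 2000, Thm. 0.1)

Cite item `wi-20398` (route FinalStateConjecture/ConcentrationCannotWait: the Liouville engine of
the no-loitering lemma and the last step of `NoVacuumBreathers`). Source read this session:
M. T. Anderson, *On stationary vacuum solutions to the Einstein equations*, Ann. Henri Poincaré 1
(2000) 977–994 = arXiv:gr-qc/0001091 [Anderson2000], §0, verbatim: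

> "A stationary space-time `(M, g)` is a 4-manifold `M` with a smooth Lorentzian metric `g`, of
> signature `(−, +, +, +)`, which has a smooth 1-parameter group `G ≈ ℝ` of isometries whose
> orbits are time-like curves in `M`. We assume throughout the paper that `M` is a chronological
> space-time, i.e. `M` admits no closed time-like curves […]. The infinitesimal generator of
> `G ≈ ℝ` is a time-like Killing vector field `X` on `M`, so that `𝓛_X g = 0`. […] The vacuum
> Einstein field equations on the space-time `(M, g)` are `r_M = 0` (0.3), where `r_M` is the
> Ricci curvature."
> **Theorem 0.1.** "Let `(M, g)` be a geodesically complete, chronological, stationary vacuum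
> space-time. Then `(M, g)` is the flat (i.e. empty) Minkowski space `(ℝ⁴, η)`, or a quotient of
> Minkowski space by a discrete group `Γ` of isometries of `ℝ³`, commuting with `G`. In particular,
> `M` is diffeomorphic to `S × ℝ`, `dθ = 0` and `u = const`."
> **Theorem 0.2.** "There is a constant `K < ∞` such that if `(M, g)` is any chronological
> stationary vacuum solution, (not geodesically complete), then `|R_M|[x] ≤ K/ρ²[x]`, where `R_M`
> is the curvature tensor of `(M, g)`, `[x]` is the Killing orbit through `x ∈ M` and
> `ρ(x) = dist_{g_S}([x], ∂S)`" (`S` the orbit space with its quotient Riemannian metric `g_S`,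
> `∂S = S̄ ∖ S` its metric boundary).

## Rendering (tree vocabulary only; `Stationary.lean`, `Causality.lean`, `Einstein.lean`,
## `Geodesic.lean`, `Curvature.lean`)

* spacetime: `𝓢 : Spacetime 4` — a connected, Hausdorff, second countable `C^∞` 4-manifold with a
  `C^∞` Lorentzian metric and a time orientation (a spacetime carrying a timelike vector field is
  time-orientable, so no generality is lost), with the standing Levi-Civita hypothesis
  `[𝓢.metric.HasLeviCivita]` of the layer;
* stationary: `𝓢.IsStationaryKilling X₀ univ` — `X₀` is a (smooth) Killing field, COMPLETE (its
  flow is a global isometric `ℝ`-action, Anderson's `G ≈ ℝ`) and timelike future-directed at EVERY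
  point (`Mext = univ`; for a timelike Killing field on a connected time-oriented spacetime one of
  `±X₀` is future-directed, so this is Anderson's "orbits are time-like curves" up to the sign of
  `X₀`);
* chronological: `𝓢.metric.IsChronological 𝓢.timeOrientation` (no closed timelike curves);
* vacuum: `𝓢.metric.toPseudoRiemannianMetric.IsRicciFlat` (`r_M = 0`);
* geodesically complete: `IsGeodesicallyComplete 𝓢.metric.toPseudoRiemannianMetric.leviCivita`
  (every geodesic extends to `ℝ`);
* conclusion: `(…leviCivita).IsFlat` — the curvature tensor vanishes identically.

## Scope (what is vendored, what is not)

VENDORED: Thm. 0.1 with the conclusion "flat" (`Anderson2000_stationaryVacuum_flat`). NOT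
vendored: the global form of the conclusion ("Minkowski space or a quotient by a discrete group of
isometries of `ℝ³` commuting with `G`; `M ≅ S × ℝ`, `dθ = 0`, `u = const`") — a classification of
complete flat chronological stationary spacetimes on top of flatness, which the consumer does not
use (it needs the Liouville statement "complete + stationary + vacuum ⇒ no curvature"); the
vendored statement is therefore WEAKER than the printed theorem, never stronger. Thm. 0.2 (the
scale-invariant curvature estimate `|R_M| ≤ K/ρ²`) is NOT vendored: it quantifies over the orbit
space `S = M/G` as a Riemannian 3-manifold, its distance to the metric (Cauchy-completion) boundary
`∂S`, and a pointwise norm of the Lorentzian curvature tensor measured through `g_S` — none of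
which exists in the tree (no quotient-manifold / orbit-space construction, no metric boundary).
Anderson notes "Theorem 0.2 implies Theorem 0.1 by letting `ρ → ∞`".

## References

* [Anderson2000] M. T. Anderson, *On stationary vacuum solutions to the Einstein equations*, Ann.
  Henri Poincaré 1 (2000) 977–994, arXiv:gr-qc/0001091: §0 (definitions, Thm. 0.1, Thm. 0.2),
  §1.1 (chronology ⇒ Hausdorff orbit space), Lemma 1.1, §2 (proof of Thm. 0.1).
* A. Lichnerowicz, *Théories relativistes de la gravitation et de l'électromagnétisme* (1955),
  §90 (the asymptotically flat case, quoted by Anderson).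
* [ONeill1983] B. O'Neill, *Semi-Riemannian Geometry*, Ch. 3 (flatness, completeness), Ch. 9
  (Killing fields), Ch. 14 (chronology).
-/

noncomputable section

open Set
open scoped Manifold ContDiff

universe u

namespace Literature.Geometry.Lorentzian

/-- **Anderson 2000, Thm. 0.1 (rigidity of complete stationary vacuum spacetimes; no asymptotic
flatness assumed).** "Let `(M, g)` be a geodesically complete, chronological, stationary vacuum
space-time. Then `(M, g)` is the flat (i.e. empty) Minkowski space `(ℝ⁴, η)`, or a quotient of
Minkowski space by a discrete group `Γ` of isometries of `ℝ³`, commuting with `G`." Rendering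
(module docstring): for a 4-dimensional spacetime `𝓢` with a complete Killing field `X₀` that is
timelike (future-directed) everywhere, chronological, Ricci-flat and geodesically complete, the
Levi-Civita connection is FLAT. The finer global conclusion and Thm. 0.2 are not vendored.
[cite: Anderson2000, Thm. 0.1] -/
def Anderson2000_stationaryVacuum_flat : Prop :=
  ∀ (𝓢 : Spacetime.{u} 4) [𝓢.metric.HasLeviCivita]
    (X₀ : Π x : 𝓢.carrier, TangentSpace (𝓡 4) x),
    𝓢.IsStationaryKilling X₀ univ →
    𝓢.metric.IsChronological 𝓢.timeOrientation →
    𝓢.metric.toPseudoRiemannianMetric.IsRicciFlat →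
    IsGeodesicallyComplete 𝓢.metric.toPseudoRiemannianMetric.leviCivita →
    𝓢.metric.toPseudoRiemannianMetric.leviCivita.IsFlat

namespace Anderson2000_stationaryVacuum_flat

variable {𝓢 : Spacetime.{u} 4} [𝓢.metric.HasLeviCivita]

/-- Unfolding: the curvature tensor of a geodesically complete, chronological, stationary vacuum
spacetime vanishes at every point and on all arguments. [cite: Anderson2000, Thm. 0.1] -/
theorem curvature_eq_zero (h : Anderson2000_stationaryVacuum_flat.{u})
    {X₀ : Π x : 𝓢.carrier, TangentSpace (𝓡 4) x} (hX : 𝓢.IsStationaryKilling X₀ univ)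
    (hchr : 𝓢.metric.IsChronological 𝓢.timeOrientation)
    (hvac : 𝓢.metric.toPseudoRiemannianMetric.IsRicciFlat)
    (hc : IsGeodesicallyComplete 𝓢.metric.toPseudoRiemannianMetric.leviCivita)
    (x : 𝓢.carrier) (Y₀ Z₀ W₀ : TangentSpace (𝓡 4) x) :
    𝓢.metric.toPseudoRiemannianMetric.leviCivita.curvature x Y₀ Z₀ W₀ = 0 :=
  (CovariantDerivative.isFlat_iff _).1 (h 𝓢 X₀ hX hchr hvac hc) x Y₀ Z₀ W₀

/-- **Liouville / no-breather form** (the use in route FinalStateConjecture/ConcentrationCannotWait):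
a geodesically complete chronological stationary vacuum spacetime that is NOT flat does not exist —
equivalently, non-flatness of a chronological stationary vacuum spacetime forces geodesic
INcompleteness (Anderson: "if `(M, g)` is a non-flat stationary vacuum space-time, then the orbit
space `S` must have a non-empty metric boundary"). [cite: Anderson2000, Thm. 0.1 and (0.4)] -/
theorem not_isGeodesicallyComplete_of_not_isFlat (h : Anderson2000_stationaryVacuum_flat.{u})
    {X₀ : Π x : 𝓢.carrier, TangentSpace (𝓡 4) x} (hX : 𝓢.IsStationaryKilling X₀ univ)
    (hchr : 𝓢.metric.IsChronological 𝓢.timeOrientation)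
    (hvac : 𝓢.metric.toPseudoRiemannianMetric.IsRicciFlat)
    (hnf : ¬ 𝓢.metric.toPseudoRiemannianMetric.leviCivita.IsFlat) :
    ¬ IsGeodesicallyComplete 𝓢.metric.toPseudoRiemannianMetric.leviCivita :=
  fun hc ↦ hnf (h 𝓢 X₀ hX hchr hvac hc)

end Anderson2000_stationaryVacuum_flat

end Literature.Geometry.Lorentzian

end
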